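import Summits.CriticalPhenomena.SAWScalingLimit.Theorems.SAWDevelopingMapHexConjectureRestrictionCocycleOfAspectBound
import Summits.CriticalPhenomena.SAWScalingLimit.Theorems.SAWDevelopingMapHexConjectureWindowLowerBoundOfWindowIneqEta
import HarnessLib

/-!
# Crux `HexConjecture` (stmt-CriticalPhenomena-0808), line `root-locality-replaces-loewner`:
the admissible restriction cocycle from the floor-ratio limit and the WINDOW INEQUALITY ALONG THE FAMILIES (WIF)

Landing target:
`Summits/CriticalPhenomena/SAWScalingLimit/Theorems/SAWDevelopingMapHexConjectureRestrictionCocycleOfWindowIneqFamilies.lean`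
(`--supports stmt-CriticalPhenomena-0808`; lead continuation prover-line-stmt-CriticalPhenomena-0808-c6-0).

The re-plumbed bootstrap of the line consumes its lever only through the WINDOW INEQUALITY ALONG THE DISCRETISATION FAMILY
(eventually along `δ → 0⁺`, at the root cell of the actual family `Λ δ`, the far mass summed over the lattice floor window is at most
`η ×` the window mass).  Quantified over admissible discretisation families of Dobrushin domains flat at both marks this is the named
statement WIF of the skeleton; it is implied by the c5 lever WAL (`windowIneqFamilies_of_windowLocality`, p125991) and by the floor-ratio
limit together with the `η`-free arch aspect bound (`windowIneqFamilies_of_aspectBound`).  `restrictionCocycle_of_windowIneqFamilies`: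
FRL ∧ WIF ⟹ the admissible restriction cocycle (conclusion VERBATIM p90257/p116941/p123521/p126051), via the conformal package, target
transport along arbitrary admissible floor families, WIF at the family itself with working radius `min ρ_package ρs`, the window maximiser and
the lower bound with `η`-dependent window bound (`windowLowerBound_of_windowIneq'`), c5's upper bound and squeeze.  Plus the floor-class
glue `hexAvoidanceCocycleFloor_of_windowIneqFamilies`.
Sources: LawlerSchrammWerner2003 (Thm 6.1), LawlerSchrammWerner2004SAW (§3.4, Prop. 2), DuminilCopinSmirnov2012 (Lemma 2).
-/

noncomputable section

open scoped BigOperators Topology NNReal ENNReal Classical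
open Filter Set MeasureTheory Metric
open Literature.Probability.LatticeModels (HexVertex hexGraph hexCenter Site)
open Literature.Probability.RandomPlanarGeometry
open Literature.Probability.RandomPlanarGeometry.SAW
open UpperHalfPlane (upperHalfPlaneSet)

namespace Summit.CriticalPhenomena.SAWScalingLimit.Theorems.HexConjecture.RootLocality

open Summit.CriticalPhenomena.SAWScalingLimit.Theorems.ObservableToSLE.FloorRatio

/-! ### The bootstrap with WIF -/

/-- **The admissible restriction cocycle from the modulus floor-ratio limit and the WINDOW INEQUALITY ALONG THE FAMILIES (WIF).**
Conclusion and first hypothesis verbatim those of `restrictionCocycle_of_floorRatioModulus` (p116941) / `…_of_windowLocality`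
(p123521) / `…_of_aspectBound` (p126051); the second hypothesis is WIF, the instance-level lever actually consumed by the bootstrap
(implied by WAL, p125991, and by FRL ∧ AAB, `windowIneqFamilies_of_aspectBound`).  Proof: the conformal package, target transport along
arbitrary admissible floor families, WIF instantiated at the family `Λ δ` itself with working radius `min ρ_package ρs`, the window
maximiser / lower bound (`windowLowerBound_of_windowIneq'`) and c5's upper bound and squeeze.
[cite: LawlerSchrammWerner2004SAW, §3.4 ("SAW satisfies restriction") and Prop. 2] -/
theorem restrictionCocycle_of_windowIneqFamilies :
    (∀ (D D' : DobrushinDomain) (ρ : ℝ) (Λ : ℝ → Finset HexVertex) (m₀ m m' : ℝ → ℤ)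
      (a b b' : ℝ → Sym2 HexVertex) (Φ : ConformalEquiv D.carrier upperHalfPlaneSet)
      (L : ℂ → ℂ) (Lb Lb' : ℂ),
      D'.carrier = D.carrier → D'.pt 0 = D.pt 0 → 0 < ρ →
      D.carrier ∩ ball (D.pt 0) ρ = {z : ℂ | (D.pt 0).im < z.im} ∩ ball (D.pt 0) ρ →
      D.carrier ∩ ball (D.pt 1) ρ = {z : ℂ | (D.pt 1).im < z.im} ∩ ball (D.pt 1) ρ →
      D.carrier ∩ ball (D'.pt 1) ρ = {z : ℂ | (D'.pt 1).im < z.im} ∩ ball (D'.pt 1) ρ →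
      (∀ᶠ δ : ℝ in 𝓝[>] 0,
        hexDomainSimplyConnected (Λ δ) ∧ a δ ∈ hexDomainBoundary (Λ δ) ∧
        b δ ∈ hexDomainBoundary (Λ δ) ∧ b' δ ∈ hexDomainBoundary (Λ δ) ∧
        Nonempty (HexMidEdgeSAW (Λ δ) (a δ) (b δ)) ∧ Nonempty (HexMidEdgeSAW (Λ δ) (a δ) (b' δ)) ∧
        (hexGraph.induce (↑(Λ δ) : Set HexVertex)).Preconnected ∧
        (∀ v ∈ Λ δ, (δ : ℂ) * hexCenter v ∈ D.carrier) ∧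
        (∀ v : HexVertex, (δ : ℂ) * hexCenter v ∈ ball (D.pt 0) ρ → (v ∈ Λ δ ↔ m₀ δ ≤ v.1 1)) ∧
        (∀ v : HexVertex, (δ : ℂ) * hexCenter v ∈ ball (D.pt 1) ρ → (v ∈ Λ δ ↔ m δ ≤ v.1 1)) ∧
        (∀ v : HexVertex, (δ : ℂ) * hexCenter v ∈ ball (D'.pt 1) ρ → (v ∈ Λ δ ↔ m' δ ≤ v.1 1))) →
      (∀ K : Set ℂ, IsCompact K → K ⊆ D.carrier →
        ∀ᶠ δ : ℝ in 𝓝[>] 0, ∀ v : HexVertex, (δ : ℂ) * hexCenter v ∈ K → v ∈ Λ δ) →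
      Tendsto (fun δ : ℝ => (δ : ℂ) * hexMidpoint (a δ)) (𝓝[>] 0) (𝓝 (D.pt 0)) →
      Tendsto (fun δ : ℝ => (δ : ℂ) * hexMidpoint (b δ)) (𝓝[>] 0) (𝓝 (D.pt 1)) →
      Tendsto (fun δ : ℝ => (δ : ℂ) * hexMidpoint (b' δ)) (𝓝[>] 0) (𝓝 (D'.pt 1)) →
      Tendsto (fun x => ‖Φ x‖) (𝓝[D.carrier] (D.pt 0)) atTop →
      Φ.HasBoundaryValue (D.pt 1) 0 →
      ContinuousOn L D.carrier → (∀ z ∈ D.carrier, Complex.exp (L z) = deriv Φ z) →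
      Tendsto L (𝓝[D.carrier] (D.pt 1)) (𝓝 Lb) → Tendsto L (𝓝[D.carrier] (D'.pt 1)) (𝓝 Lb') →
      Tendsto (fun δ : ℝ =>
        ‖hexParafermionicObservable (Λ δ) (a δ) hexCriticalFugacity (5 / 8) (b' δ) /
          hexParafermionicObservable (Λ δ) (a δ) hexCriticalFugacity (5 / 8) (b δ)‖) (𝓝[>] 0)
        (𝓝 (Real.exp ((5 / 8) * (Lb' - Lb).re)))) →
    (∀ (D : DobrushinDomain) (ρ : ℝ) (Λ : ℝ → Finset HexVertex) (m : ℝ → ℤ) (a b : ℝ → Sym2 HexVertex)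
      (φ : ConformalEquiv upperHalfPlaneSet D.carrier),
      0 < ρ →
      D.carrier ∩ ball (D.pt 0) ρ = {z : ℂ | (D.pt 0).im < z.im} ∩ ball (D.pt 0) ρ →
      D.carrier ∩ ball (D.pt 1) ρ = {z : ℂ | (D.pt 1).im < z.im} ∩ ball (D.pt 1) ρ →
      D.IsChordalUniformizing φ →
      (∀ᶠ δ : ℝ in 𝓝[>] 0,
        hexDomainSimplyConnected (Λ δ) ∧ (hexGraph.induce (↑(Λ δ) : Set HexVertex)).Preconnected ∧
        a δ ∈ hexDomainBoundary (Λ δ) ∧ b δ ∈ hexDomainBoundary (Λ δ) ∧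
        Nonempty (HexMidEdgeSAW (Λ δ) (a δ) (b δ)) ∧
        (∀ v ∈ Λ δ, (δ : ℂ) * hexCenter v ∈ D.carrier ∧ m δ ≤ v.1 1) ∧
        (∀ v : HexVertex, (δ : ℂ) * hexCenter v ∈ ball (D.pt 0) ρ ∪ ball (D.pt 1) ρ →
          (v ∈ Λ δ ↔ m δ ≤ v.1 1))) →
      (∀ K : Set ℂ, IsCompact K → K ⊆ D.carrier →
        ∀ᶠ δ : ℝ in 𝓝[>] 0, ∀ v : HexVertex, (δ : ℂ) * hexCenter v ∈ K → v ∈ Λ δ) →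
      Tendsto (fun δ : ℝ => (δ : ℂ) * hexMidpoint (a δ)) (𝓝[>] 0) (𝓝 (D.pt 0)) →
      Tendsto (fun δ : ℝ => (δ : ℂ) * hexMidpoint (b δ)) (𝓝[>] 0) (𝓝 (D.pt 1)) →
      ∃ ρs : ℝ, 0 < ρs ∧ ρs ≤ ρ ∧ ∀ ρ₁ : ℝ, 0 < ρ₁ → ρ₁ ≤ ρs → ∀ η : ℝ, 0 < η → ∃ θb : ℝ, 0 < θb ∧
        ∀ θ₀ : ℝ, 0 < θ₀ → θ₀ ≤ θb → ∃ θ₁ : ℝ, 0 < θ₁ ∧ θ₁ < θ₀ ∧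
        ∀ᶠ δ : ℝ in 𝓝[>] 0, ∀ x : Site 2, x 1 = m δ → a δ = s((x - Pi.single 1 1, 1), (x, 0)) →
          ∑ d ∈ Finset.Icc ⌈θ₁ * (ρ₁ / 2 / δ)⌉ ⌊θ₀ * (ρ₁ / 2 / δ)⌋,
              (∑ γ : HexMidEdgeSAW (Λ δ) s((x - Pi.single 1 1, 1), (x, 0))
                s((x + Pi.single 0 d - Pi.single 1 1, 1), (x + Pi.single 0 d, 0)),
              if ∃ v ∈ γ.verts, ρ₁ / 2 / δ ≤ dist (hexCenter v) (hexMidpoint s((x - Pi.single 1 1, 1), (x, 0)))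
              then hexCriticalFugacity ^ γ.length else 0) ≤
            η * ∑ d ∈ Finset.Icc ⌈θ₁ * (ρ₁ / 2 / δ)⌉ ⌊θ₀ * (ρ₁ / 2 / δ)⌋,
              ∑ γ : HexMidEdgeSAW (Λ δ) s((x - Pi.single 1 1, 1), (x, 0))
                s((x + Pi.single 0 d - Pi.single 1 1, 1), (x + Pi.single 0 d, 0)), hexCriticalFugacity ^ γ.length) →
  ∀ (D D' : DobrushinDomain) (ρ : ℝ) (φ : ConformalEquiv upperHalfPlaneSet D.carrier)
  (Φ : ConformalEquiv (upperHalfPlaneSet \ φ.pullbackHull D') upperHalfPlaneSet) (d : ℝ)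
  (Λ Λ' : ℝ → Finset HexVertex) (m : ℝ → ℤ) (a b : ℝ → Sym2 HexVertex),
  (0 < ρ ∧ (D.pt 1).im = (D.pt 0).im ∧ D.carrier ⊆ {z : ℂ | (D.pt 0).im < z.im} ∧
  D.carrier ∩ ball (D.pt 0) ρ = {z : ℂ | (D.pt 0).im < z.im} ∩ ball (D.pt 0) ρ ∧
  D.carrier ∩ ball (D.pt 1) ρ = {z : ℂ | (D.pt 1).im < z.im} ∩ ball (D.pt 1) ρ) → D.IsHullSubdomain D' → D.IsChordalUniformizing φ →
  IsRestrictionMap (φ.pullbackHull D') Φ → HasRestrictionDeriv (φ.pullbackHull D') Φ d →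
  (∀ᶠ δ : ℝ in 𝓝[>] 0,
  Λ' δ ⊆ Λ δ ∧ hexDomainSimplyConnected (Λ δ) ∧ hexDomainSimplyConnected (Λ' δ) ∧
  (hexGraph.induce (↑(Λ δ) : Set HexVertex)).Preconnected ∧
  (hexGraph.induce (↑(Λ' δ) : Set HexVertex)).Preconnected ∧
  a δ ∈ hexDomainBoundary (Λ δ) ∧ b δ ∈ hexDomainBoundary (Λ δ) ∧
  a δ ∈ hexDomainBoundary (Λ' δ) ∧ b δ ∈ hexDomainBoundary (Λ' δ) ∧
  Nonempty (HexMidEdgeSAW (Λ' δ) (a δ) (b δ)) ∧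
  (∀ v ∈ Λ δ, (δ : ℂ) * hexCenter v ∈ D.carrier ∧ m δ ≤ v.1 1) ∧
  (∀ v ∈ Λ' δ, (δ : ℂ) * hexCenter v ∈ D'.carrier) ∧
  (∀ v : HexVertex, (δ : ℂ) * hexCenter v ∈ ball (D.pt 0) ρ ∪ ball (D.pt 1) ρ →
  ((v ∈ Λ δ ↔ m δ ≤ v.1 1) ∧ (v ∈ Λ' δ ↔ m δ ≤ v.1 1)))) →
  (∀ K : Set ℂ, IsCompact K → K ⊆ D.carrier →
  ∀ᶠ δ : ℝ in 𝓝[>] 0, ∀ v : HexVertex, (δ : ℂ) * hexCenter v ∈ K → v ∈ Λ δ) →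
  (∀ K : Set ℂ, IsCompact K → K ⊆ D'.carrier →
  ∀ᶠ δ : ℝ in 𝓝[>] 0, ∀ v : HexVertex, (δ : ℂ) * hexCenter v ∈ K → v ∈ Λ' δ) →
  Tendsto (fun δ : ℝ => (δ : ℂ) * hexMidpoint (a δ)) (𝓝[>] 0) (𝓝 (D.pt 0)) →
  Tendsto (fun δ : ℝ => (δ : ℂ) * hexMidpoint (b δ)) (𝓝[>] 0) (𝓝 (D.pt 1)) →
  Tendsto (fun δ : ℝ => (∑ γ : HexMidEdgeSAW (Λ' δ) (a δ) (b δ), hexCriticalFugacity ^ γ.length) /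
  (∑ γ : HexMidEdgeSAW (Λ δ) (a δ) (b δ), hexCriticalFugacity ^ γ.length)) (𝓝[>] 0)
  (𝓝 (d ^ ((5 : ℝ) / 8))) := by
  intro hFRM hWIF D D' ρ φ Φ d Λ Λ' m a b hfl hD' hφ hΦ hd hev hKΛ hKΛ' ha hb
  obtain ⟨hρ, -, -, hflat0, hflat1⟩ := hfl
  obtain ⟨Ψ, L, Lb, Ψ', L', L'b, ρp, R, _, _, hρp, hρpρ, hΨinf, hΨb, hLc, hLe, hLb, hΨ'inf, hΨ'b, hL'c,
    hL'e, hL'b, hflat0p, hflat1p, hfloor, hR, -, -, -⟩ :=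
    exists_conformalPackageGrowth D D' ρ φ Φ d hρ hflat0 hflat1 hD' hφ hΦ hd
  -- the single-family admissibility clause (for the window inequality along the family)
  have hdaux₀ : dist (D.pt 0 + ((ρp / 16 : ℝ) : ℂ)) (D.pt 0) = ρp / 16 := dist_pt_add_real _ (by positivity)
  obtain ⟨_, _, -, hevAB₀⟩ := floorData D D' ρ Λ Λ' m a b hρ hev ha hb (s := D.pt 0 + ((ρp / 16 : ℝ) : ℂ))
    (pt_add_ne (by positivity)) (by simp) (by rw [hdaux₀]; linarith) one_pos (by rw [hdaux₀]; linarith)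
  have hevW : ∀ᶠ δ : ℝ in 𝓝[>] 0,
      hexDomainSimplyConnected (Λ δ) ∧ (hexGraph.induce (↑(Λ δ) : Set HexVertex)).Preconnected ∧
      a δ ∈ hexDomainBoundary (Λ δ) ∧ b δ ∈ hexDomainBoundary (Λ δ) ∧
      Nonempty (HexMidEdgeSAW (Λ δ) (a δ) (b δ)) ∧
      (∀ v ∈ Λ δ, (δ : ℂ) * hexCenter v ∈ D.carrier ∧ m δ ≤ v.1 1) ∧
      (∀ v : HexVertex, (δ : ℂ) * hexCenter v ∈ ball (D.pt 0) ρ ∪ ball (D.pt 1) ρ →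
        (v ∈ Λ δ ↔ m δ ≤ v.1 1)) := by
    filter_upwards [hev, hevAB₀] with δ hevδ hAB
    obtain ⟨-, hscΛ, -, hconn, -, haΛ, hbΛ, -, -, -, hΛD, -, hrows⟩ := hevδ
    obtain ⟨_, _, _, -, -, -, -, -, -, -, -, -, -, -, -, -, hne_ab, -⟩ := hAB
    exact ⟨hscΛ, hconn, haΛ, hbΛ, hne_ab, hΛD, fun v hv => (hrows v hv).1⟩
  obtain ⟨ρs, hρs, hρsρ, hWρ⟩ := hWIF D ρ Λ m a b φ hρ hflat0 hflat1 hφ hevW hKΛ ha hb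
  -- the working radius
  set ρ₁ : ℝ := min ρp ρs with hρ₁def
  have hρ₁ : 0 < ρ₁ := lt_min hρp hρs
  have hρ₁p : ρ₁ ≤ ρp := min_le_left _ _
  have hρ₁ρ : ρ₁ ≤ ρ := hρ₁p.trans hρpρ
  have hflat0' : D'.carrier ∩ ball (D.pt 0) ρ₁ = {z : ℂ | (D.pt 0).im < z.im} ∩ ball (D.pt 0) ρ₁ :=
    flat_of_subset hflat0p (ball_subset_ball hρ₁p) rfl
  have hflat1' : D'.carrier ∩ ball (D.pt 1) ρ₁ = {z : ℂ | (D.pt 1).im < z.im} ∩ ball (D.pt 1) ρ₁ :=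
    flat_of_subset hflat1p (ball_subset_ball hρ₁p) rfl
  have hWin := hWρ ρ₁ hρ₁ (min_le_right _ _)
  -- target transport along arbitrary admissible floor families (as c5)
  have hQ : ∀ (e : ℝ → Sym2 HexVertex) (t : ℝ), 0 < t → t ≤ ρ₁ / 4 →
      Tendsto (fun δ : ℝ => (δ : ℂ) * hexMidpoint (e δ)) (𝓝[>] 0) (𝓝 (D.pt 0 + t)) →
      (∀ᶠ δ : ℝ in 𝓝[>] 0, e δ ∈ hexDomainBoundary (Λ δ) ∧ e δ ∈ hexDomainBoundary (Λ' δ) ∧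
        Nonempty (HexMidEdgeSAW (Λ δ) (a δ) (e δ)) ∧ Nonempty (HexMidEdgeSAW (Λ' δ) (a δ) (e δ)) ∧
        ∃ x yy : Site 2, a δ = s((x - Pi.single 1 1, 1), (x, 0)) ∧
          e δ = s((yy - Pi.single 1 1, 1), (yy, 0)) ∧ yy 1 = x 1 ∧ yy ≠ x) →
      Tendsto (fun δ : ℝ =>
        ((∑ γ : HexMidEdgeSAW (Λ' δ) (a δ) (b δ), hexCriticalFugacity ^ γ.length) /
          (∑ γ : HexMidEdgeSAW (Λ' δ) (a δ) (e δ), hexCriticalFugacity ^ γ.length)) *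
        ((∑ γ : HexMidEdgeSAW (Λ δ) (a δ) (e δ), hexCriticalFugacity ^ γ.length) /
          (∑ γ : HexMidEdgeSAW (Λ δ) (a δ) (b δ), hexCriticalFugacity ^ γ.length)))
        (𝓝[>] 0) (𝓝 (R t)) := by
    intro e t ht0 htρ he heE
    obtain ⟨hsfr, hsfr', -, Ls, L's, hLs, hL's, hRt, -⟩ := hfloor t ht0 (by linarith [hρ₁p])
    rw [← hRt]
    exact floorFamily_targetTransport hFRM D D' ρ Λ Λ' m a b hρ hD' hev hKΛ hKΛ' ha hb hρ₁ hρ₁ρ hflat0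
      hflat1 hflat0' hflat1' Ψ L Lb Ψ' L' L'b hΨinf hΨb hLc hLe hLb hΨ'inf hΨ'b hL'c hL'e hL'b ht0 htρ
      hsfr hsfr' hLs hL's e he heE
  have hupper := windowUpperBound D D' ρ Λ Λ' m a b hρ hev ha hb hρ₁ hρ₁ρ hR hQ
  have hlower := windowLowerBound_of_windowIneq' D D' ρ Λ Λ' m a b hρ hev ha hb hρ₁ hρ₁ρ hR hQ hWin
  -- conclusion
  rw [Metric.tendsto_nhds]
  intro ε hε
  set c : ℝ := d ^ ((5 : ℝ) / 8) with hc
  set η : ℝ := min (1 / 2) (ε / (2 * (|c| + 3))) with hη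
  have hηpos : 0 < η := lt_min (by norm_num) (by positivity)
  have hη2 : η ≤ 1 / 2 := min_le_left _ _
  have hηε : η * (2 * (|c| + 3)) ≤ ε := by
    have : η ≤ ε / (2 * (|c| + 3)) := min_le_right _ _
    rwa [le_div_iff₀ (by positivity)] at this
  filter_upwards [hupper η hηpos, hlower η hηpos hη2] with δ hup hlo
  rw [Real.dist_eq]
  exact squeeze_abs_lt hηpos hη2 hηε hup hlo

/-! ### The floor class from FRL and WIF -/

/-- **The floor-class avoidance cocycle from the floor-ratio limit and WIF.**
`FloorRatioLimit → WindowIneqFamilies → HexAvoidanceCocycleFloor`: the restriction cocycle of this file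
(`restrictionCocycle_of_windowIneqFamilies`), the canonical transfer under the hull approximation
(`FloorRatio.canonicalTransfer_of_hullApprox`, `stub_avoidanceCocycleFloor_hullApprox`) and the sandwich
(`hexAvoidanceCocycleFloor_of_floorRestrictionLimit`).
[cite: LawlerSchrammWerner2004SAW, §3.4 ("SAW satisfies restriction") and Prop. 2] -/
theorem hexAvoidanceCocycleFloor_of_windowIneqFamilies
    (hF : ∀ (D D' : DobrushinDomain) (ρ : ℝ) (Λ : ℝ → Finset HexVertex) (m₀ m m' : ℝ → ℤ) (a b b' : ℝ → Sym2 HexVertex) (Φ : ConformalEquiv D.carrier upperHalfPlaneSet) (L : ℂ → ℂ) (Lb Lb' : ℂ), D'.carrier = D.carrier → D'.pt 0 = D.pt 0 → 0 < ρ → D.carrier ∩ ball (D.pt 0) ρ = {z : ℂ | (D.pt 0).im < z.im} ∩ ball (D.pt 0) ρ → D.carrier ∩ ball (D.pt 1) ρ = {z : ℂ | (D.pt 1).im < z.im} ∩ ball (D.pt 1) ρ → D.carrier ∩ ball (D'.pt 1) ρ = {z : ℂ | (D'.pt 1).im < z.im} ∩ ball (D'.pt 1) ρ → (∀ᶠ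 δ : ℝ in 𝓝[>] 0, hexDomainSimplyConnected (Λ δ) ∧ a δ ∈ hexDomainBoundary (Λ δ) ∧ b δ ∈ hexDomainBoundary (Λ δ) ∧ b' δ ∈ hexDomainBoundary (Λ δ) ∧ Nonempty (HexMidEdgeSAW (Λ δ) (a δ) (b δ)) ∧ Nonempty (HexMidEdgeSAW (Λ δ) (a δ) (b' δ)) ∧ (hexGraph.induce (↑(Λ δ) : Set HexVertex)).Preconnected ∧ (∀ v ∈ Λ δ, (δ : ℂ) * hexCenter v ∈ D.carrier) ∧ (∀ v : HexVertex, (δ : ℂ) * hexCenter v ∈ ball (D.pt 0) ρ → (v ∈ Λ δ ↔ m₀ δ ≤ v.1 1)) ∧ (∀ v : HexVertex, (δ : ℂ) * hexCenter v ∈ ball (D.pt 1) ρ → (v ∈ Λ δ ↔ m δ ≤ v.1 1)) ∧ (∀ v : HexVertex, (δ : ℂ) * hexCenter v ∈ ball (D'.pt 1) ρ → (v ∈ Λ δ ↔ m' δ ≤ v.1 1))) → (∀ K : Set ℂ, IsCompact K → K ⊆ D.carrier → ∀ᶠ δ : ℝ in 𝓝[>] 0, ∀ v : HexVertex, (δ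 : ℂ) * hexCenter v ∈ K → v ∈ Λ δ) → Tendsto (fun δ : ℝ => (δ : ℂ) * hexMidpoint (a δ)) (𝓝[>] 0) (𝓝 (D.pt 0)) → Tendsto (fun δ : ℝ => (δ : ℂ) * hexMidpoint (b δ)) (𝓝[>] 0) (𝓝 (D.pt 1)) → Tendsto (fun δ : ℝ => (δ : ℂ) * hexMidpoint (b' δ)) (𝓝[>] 0) (𝓝 (D'.pt 1)) → Tendsto (fun x => ‖Φ x‖) (𝓝[D.carrier] (D.pt 0)) atTop → Φ.HasBoundaryValue (D.pt 1) 0 → ContinuousOn L D.carrier → (∀ z ∈ D.carrier, Complex.exp (L z) = deriv Φ z) → Tendsto L (𝓝[D.carrier] (D.pt 1)) (𝓝 Lb) → Tendsto L (𝓝[D.carrier] (D'.pt 1)) (𝓝 Lb') → Tendsto (fun δ : ℝ => ‖hexParafermionicObservable (Λ δ) (a δ) hexCriticalFugacity (5 / 8) (b' δ) / hexParafermionicObservable (Λ δ) (a δ) hexCriticalFugacity (5 / 8) (b δ)‖) (𝓝[>] 0) (𝓝 (Real.exp ((5 / 8) * (Lb' - Lb).re))))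
    (hWIF : ∀ (D : DobrushinDomain) (ρ : ℝ) (Λ : ℝ → Finset HexVertex) (m : ℝ → ℤ) (a b : ℝ → Sym2 HexVertex)
      (φ : ConformalEquiv upperHalfPlaneSet D.carrier),
      0 < ρ →
      D.carrier ∩ ball (D.pt 0) ρ = {z : ℂ | (D.pt 0).im < z.im} ∩ ball (D.pt 0) ρ →
      D.carrier ∩ ball (D.pt 1) ρ = {z : ℂ | (D.pt 1).im < z.im} ∩ ball (D.pt 1) ρ →
      D.IsChordalUniformizing φ →
      (∀ᶠ δ : ℝ in 𝓝[>] 0,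
        hexDomainSimplyConnected (Λ δ) ∧ (hexGraph.induce (↑(Λ δ) : Set HexVertex)).Preconnected ∧
        a δ ∈ hexDomainBoundary (Λ δ) ∧ b δ ∈ hexDomainBoundary (Λ δ) ∧
        Nonempty (HexMidEdgeSAW (Λ δ) (a δ) (b δ)) ∧
        (∀ v ∈ Λ δ, (δ : ℂ) * hexCenter v ∈ D.carrier ∧ m δ ≤ v.1 1) ∧
        (∀ v : HexVertex, (δ : ℂ) * hexCenter v ∈ ball (D.pt 0) ρ ∪ ball (D.pt 1) ρ →
          (v ∈ Λ δ ↔ m δ ≤ v.1 1))) →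
      (∀ K : Set ℂ, IsCompact K → K ⊆ D.carrier →
        ∀ᶠ δ : ℝ in 𝓝[>] 0, ∀ v : HexVertex, (δ : ℂ) * hexCenter v ∈ K → v ∈ Λ δ) →
      Tendsto (fun δ : ℝ => (δ : ℂ) * hexMidpoint (a δ)) (𝓝[>] 0) (𝓝 (D.pt 0)) →
      Tendsto (fun δ : ℝ => (δ : ℂ) * hexMidpoint (b δ)) (𝓝[>] 0) (𝓝 (D.pt 1)) →
      ∃ ρs : ℝ, 0 < ρs ∧ ρs ≤ ρ ∧ ∀ ρ₁ : ℝ, 0 < ρ₁ → ρ₁ ≤ ρs → ∀ η : ℝ, 0 < η → ∃ θb : ℝ, 0 < θb ∧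
        ∀ θ₀ : ℝ, 0 < θ₀ → θ₀ ≤ θb → ∃ θ₁ : ℝ, 0 < θ₁ ∧ θ₁ < θ₀ ∧
        ∀ᶠ δ : ℝ in 𝓝[>] 0, ∀ x : Site 2, x 1 = m δ → a δ = s((x - Pi.single 1 1, 1), (x, 0)) →
          ∑ d ∈ Finset.Icc ⌈θ₁ * (ρ₁ / 2 / δ)⌉ ⌊θ₀ * (ρ₁ / 2 / δ)⌋,
              (∑ γ : HexMidEdgeSAW (Λ δ) s((x - Pi.single 1 1, 1), (x, 0))
                s((x + Pi.single 0 d - Pi.single 1 1, 1), (x + Pi.single 0 d, 0)),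
              if ∃ v ∈ γ.verts, ρ₁ / 2 / δ ≤ dist (hexCenter v) (hexMidpoint s((x - Pi.single 1 1, 1), (x, 0)))
              then hexCriticalFugacity ^ γ.length else 0) ≤
            η * ∑ d ∈ Finset.Icc ⌈θ₁ * (ρ₁ / 2 / δ)⌉ ⌊θ₀ * (ρ₁ / 2 / δ)⌋,
              ∑ γ : HexMidEdgeSAW (Λ δ) s((x - Pi.single 1 1, 1), (x, 0))
                s((x + Pi.single 0 d - Pi.single 1 1, 1), (x + Pi.single 0 d, 0)), hexCriticalFugacity ^ γ.length) :
    ∀ (D D' : DobrushinDomain) (ρ : ℝ) (a b : ℝ → HexVertex) (μ : Measure (CurveClass ℂ)),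
      (0 < ρ ∧ (D.pt 1).im = (D.pt 0).im ∧ D.carrier ⊆ {z : ℂ | (D.pt 0).im < z.im} ∧
        D.carrier ∩ ball (D.pt 0) ρ = {z : ℂ | (D.pt 0).im < z.im} ∩ ball (D.pt 0) ρ ∧
        D.carrier ∩ ball (D.pt 1) ρ = {z : ℂ | (D.pt 1).im < z.im} ∩ ball (D.pt 1) ρ) →
      IsEmbEndpointApprox hexGraph hexCenter D a b →
      (∀ᶠ δ : ℝ in 𝓝[>] 0,
        (a δ ∈ embMeshDomain hexGraph hexCenter D.carrier δ ∧
          ∃ w, hexGraph.Adj (a δ) w ∧ ¬ (hexDomainGraph D.carrier δ).Adj (a δ) w) ∧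
        (b δ ∈ embMeshDomain hexGraph hexCenter D.carrier δ ∧
          ∃ w, hexGraph.Adj (b δ) w ∧ ¬ (hexDomainGraph D.carrier δ).Adj (b δ) w)) →
      D.IsHullSubdomain D' → IsSLELaw ((8 : ℝ≥0) / 3) D μ →
      Tendsto (fun δ : ℝ =>
        ((hexSAWLaw D.carrier δ (a δ) (b δ)).map
            (fun γ : HexDomainSAW D.carrier δ (a δ) (b δ) => γ.curve))
          (CurveClass.rangeSubset (closure D'.carrier)))
        (𝓝[>] 0) (𝓝 (μ (CurveClass.rangeSubset (closure D'.carrier)))) :=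
  hexAvoidanceCocycleFloor_of_floorRestrictionLimit
    (canonicalTransfer_of_hullApprox stub_avoidanceCocycleFloor_hullApprox
      (restrictionCocycle_of_windowIneqFamilies hF hWIF))


/-! ### Registered form -/

/-- **Registered sub-goal `stub_minRadiusPos`** (crux item stmt-CriticalPhenomena-0808, line `root-locality-replaces-loewner`,
lead continuation c6): the working radius `min ρ_package ρs` is positive and below both (`lt_min`/`min_le`). [folklore] -/
theorem stub_minRadiusPos : ∀ (p s : ℝ), 0 < p → 0 < s → 0 < min p s ∧ min p s ≤ p ∧ min p s ≤ s :=
  fun _ _ hp hs => ⟨lt_min hp hs, min_le_left _ _, min_le_right _ _⟩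

end Summit.CriticalPhenomena.SAWScalingLimit.Theorems.HexConjecture.RootLocality

end
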